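import Literature.Analysis.FluidPDE.SteadyNSLiouvilleHarmonicGradient
import Literature.Analysis.FluidPDE.NormalisedPressureDischarge
import Literature.Analysis.FluidPDE.RieszPressureL3
import Literature.Analysis.FluidPDE.LerayProfileCalculus
import HarnessLib

/-!
# The pressure of a steady solution on a large ball: Calderón–Zygmund part plus a harmonic
# part of controlled oscillation

Analysis/FluidPDE proof file (everything PROVED, no definitions, no named facts) on the discharge
path of the named facts `Literature.Analysis.FluidPDE.wangYang2026_liouville_velocity_log` and
`…_vorticity_log` (`SteadyNSLiouville.lean`; W. Wang, G. Yang, arXiv:2608.06040, Thms 1.5–1.6).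
For a smooth steady solution `(u, p)` of `−Δu + (u·∇)u + ∇p = 0`, `div u = 0` on `ℝ³` and a scale
`R > 0`, let `w = χ u` with `χ = cutoff(8R)` (`= 1` on `|x| ≤ 8R`, `= 0` for `|x| ≥ 16R`) and let
`P = p̃[w]` be the tree's normalised (Riesz-transform) pressure of the test field `w`
(`normalisedPressure`, Tao 2011 (35); `ΔP = −∂ᵢ∂ⱼ(wᵢwⱼ)` by the tree's proved
`laplacian_normalisedPressure_holds`). This is the classical splitting of the pressure on a
ball (Galdi 2011, proof of Thm X.9.5; Seregin–Šverák 2009): we prove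

* `laplacian_sub_normalisedPressure_cutoff` — `P ∈ C²` and `h = p − P` is **harmonic on
  `B(0, 8R)`** (there `w = u` locally, so `ΔP = −div((u·∇)u) = −tr(Du∘Du) = Δp`, by the tree's
  `divergence_convect_self_eq` and `IsLerayProfile.laplacian_pressure_eq`);
* `abs_sub_sub_le_of_harmonic_on_ball` — **oscillation of the harmonic part**: for `|x| ≤ 2R`,
  `|h(x) − h(0)| ≤ 2R (R⁻⁵M₂ ∫_{B̄(0,4R)}|u| + R⁻⁴M₁ ∫_{B̄(0,4R)}|u|² + R⁻⁴M₁ ∫_{B̄(0,4R)}|P|)`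
  (mean-value inequality on the convex ball and the interior gradient bound
  `abs_fderiv_sub_apply_le_of_steady` of `SteadyNSLiouvilleHarmonicGradient`);
* `lintegral_rpow_normalisedPressure_cutoff_le` — **the Calderón–Zygmund part in `L^{3/2}`**:
  `∫ |P|^{3/2} ≤ C_S^{3/2} ∫_{B̄(0,16R)} |u|³` (Stein's bound `‖p̃[w]‖_{3/2} ≤ C_S ‖w‖²_{L³}`,
  the tree's `eLpNorm_normalisedPressure_le_steinConst'`, and `|w| ≤ 1_{B̄(0,16R)}|u|`).

## References

* G. P. Galdi, *An introduction to the mathematical theory of the Navier–Stokes equations.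
  Steady-state problems*, 2nd ed. (2011), proof of Thm X.9.5. [Galdi2011]
* T. Tao, arXiv:1108.1165, (35) (the normalised pressure). [Tao2011]
* E. M. Stein, *Singular integrals and differentiability properties of functions* (1970),
  Ch. II §4.2 Thm 3. [Stein1971]
-/

noncomputable section

open MeasureTheory Set Filter Metric InnerProductSpace Function
open scoped RealInnerProductSpace Laplacian Topology ENNReal NNReal

namespace Literature.Analysis.FluidPDE

/-! ### The cut-off field `w = χ u` -/

section CutoffField

variable {u : EuclideanSpace ℝ (Fin 3) → EuclideanSpace ℝ (Fin 3)} {R : ℝ}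

/-- `w = χ u` is smooth when `u` is. [folklore] -/
theorem contDiff_cutoff_eight_smul (hu : ContDiff ℝ ((⊤ : ℕ∞) : WithTop ℕ∞) u) (R : ℝ) :
    ContDiff ℝ ((⊤ : ℕ∞) : WithTop ℕ∞) fun x => cutoff (8 * R) x • u x :=
  (contDiff_cutoff (n := ⊤) (8 * R)).smul hu

/-- `w = χ u` vanishes off `B̄(0, 16R)`. [folklore] -/
theorem cutoff_eight_smul_eq_zero (hR : 0 < R) {x : EuclideanSpace ℝ (Fin 3)}
    (hx : x ∉ closedBall (0 : EuclideanSpace ℝ (Fin 3)) (16 * R)) :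
    cutoff (8 * R) x • u x = 0 := by
  rw [mem_closedBall_zero_iff, not_le] at hx
  rw [cutoff_eq_zero (by positivity : 0 < 8 * R) (by linarith), zero_smul]

/-- `w = χ u` has compact support (in `B̄(0, 16R)`). [folklore] -/
theorem hasCompactSupport_cutoff_eight_smul (hR : 0 < R) :
    HasCompactSupport fun x => cutoff (8 * R) x • u x :=
  HasCompactSupport.intro' (isCompact_closedBall 0 (16 * R)) isClosed_closedBall
    fun _ hx => cutoff_eight_smul_eq_zero hR hx

/-- `|w| ≤ 1_{B̄(0,16R)} |u|` pointwise. [folklore] -/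
theorem norm_cutoff_eight_smul_le (hR : 0 < R) (x : EuclideanSpace ℝ (Fin 3)) :
    ‖cutoff (8 * R) x • u x‖ ≤ (closedBall (0 : EuclideanSpace ℝ (Fin 3)) (16 * R)).indicator (fun x => ‖u x‖) x := by
  by_cases hx : x ∈ closedBall (0 : EuclideanSpace ℝ (Fin 3)) (16 * R)
  · rw [indicator_of_mem hx, norm_smul, Real.norm_eq_abs]
    calc |cutoff (8 * R) x| * ‖u x‖ ≤ 1 * ‖u x‖ :=
          mul_le_mul_of_nonneg_right (abs_cutoff_le_one _ _) (norm_nonneg _)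
      _ = ‖u x‖ := one_mul _
  · rw [indicator_of_notMem hx, cutoff_eight_smul_eq_zero hR hx, norm_zero]

/-- `w = χ u` has finite energy (continuous with compact support). [folklore] -/
theorem lintegral_enorm_cutoff_eight_smul_sq_lt_top (hu : Continuous u) (hR : 0 < R) :
    (∫⁻ x, ‖cutoff (8 * R) x • u x‖ₑ ^ 2) < ⊤ := by
  have hw : Continuous fun x => cutoff (8 * R) x • u x :=
    (contDiff_cutoff (n := 0) (8 * R)).continuous.smul hu
  obtain ⟨B, hB⟩ := (hasCompactSupport_cutoff_eight_smul (u := u) hR).exists_bound_of_continuous hw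
  have hpt : ∀ x, ‖cutoff (8 * R) x • u x‖ₑ ^ 2 ≤
      (closedBall (0 : EuclideanSpace ℝ (Fin 3)) (16 * R)).indicator (fun _ => ENNReal.ofReal (B ^ 2)) x := by
    intro x
    by_cases hx : x ∈ closedBall (0 : EuclideanSpace ℝ (Fin 3)) (16 * R)
    · rw [indicator_of_mem hx, ← ofReal_norm, ← ENNReal.ofReal_pow (norm_nonneg _)]
      exact ENNReal.ofReal_le_ofReal (pow_le_pow_left₀ (norm_nonneg _) (hB x) 2)
    · rw [indicator_of_notMem hx, cutoff_eight_smul_eq_zero hR hx, enorm_zero, zero_pow two_ne_zero]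
  calc (∫⁻ x, ‖cutoff (8 * R) x • u x‖ₑ ^ 2)
      ≤ ∫⁻ x, (closedBall (0 : EuclideanSpace ℝ (Fin 3)) (16 * R)).indicator (fun _ => ENNReal.ofReal (B ^ 2)) x :=
        lintegral_mono hpt
    _ = ENNReal.ofReal (B ^ 2) * volume (closedBall (0 : EuclideanSpace ℝ (Fin 3)) (16 * R)) := by
        rw [lintegral_indicator measurableSet_closedBall, setLIntegral_const]
    _ < ⊤ := ENNReal.mul_lt_top ENNReal.ofReal_lt_top measure_closedBall_lt_top

/-- On the open ball `B(0, 8R)` the cut-off field agrees with `u` near every point. [folklore] -/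
theorem cutoff_eight_smul_eventuallyEq (hR : 0 < R) {x : EuclideanSpace ℝ (Fin 3)}
    (hx : x ∈ ball (0 : EuclideanSpace ℝ (Fin 3)) (8 * R)) :
    (fun y => cutoff (8 * R) y • u y) =ᶠ[𝓝 x] u := by
  filter_upwards [isOpen_ball.mem_nhds hx] with y hy
  rw [mem_ball_zero_iff] at hy
  rw [cutoff_eq_one (by positivity : 0 < 8 * R) hy.le, one_smul]

end CutoffField

/-! ### The Calderón–Zygmund part and the harmonicity of the remainder -/

/-- **Harmonicity of `p − p̃[χu]` on `B(0, 8R)`.** For a steady solution (`IsLerayProfile 1 0 u p`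
with `u` smooth and `p ∈ C²`) and `R > 0`, the normalised pressure `P = p̃[w]` of the cut-off
field `w = cutoff(8R) • u` is `C²`, and `Δ(p − P) = 0` on the open ball `B(0, 8R)`: there
`w = u` locally, so `ΔP = −div((w·∇)w + (div w) w) = −div((u·∇)u) = −tr(Du ∘ Du) = Δp`
(`laplacian_normalisedPressure_holds`, `divergence_convect_self_eq`,
`IsLerayProfile.laplacian_pressure_eq`). [cite: Galdi2011, Thm X.9.5 (proof)] -/
theorem laplacian_sub_normalisedPressure_cutoff {u : EuclideanSpace ℝ (Fin 3) → EuclideanSpace ℝ (Fin 3)}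
    {p : EuclideanSpace ℝ (Fin 3) → ℝ} (hprof : IsLerayProfile 1 0 u p)
    (hu : ContDiff ℝ ((⊤ : ℕ∞) : WithTop ℕ∞) u) (hp : ContDiff ℝ 2 p) {R : ℝ} (hR : 0 < R) :
    ContDiff ℝ 2 (normalisedPressure fun x => cutoff (8 * R) x • u x) ∧
      ∀ x ∈ ball (0 : EuclideanSpace ℝ (Fin 3)) (8 * R),
        (Δ (fun y => p y - normalisedPressure (fun x => cutoff (8 * R) x • u x) y)) x = 0 := by
  have hw := contDiff_cutoff_eight_smul hu R
  have hE := lintegral_enorm_cutoff_eight_smul_sq_lt_top (R := R) hu.continuous hR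
  obtain ⟨hP2, hΔP⟩ := laplacian_normalisedPressure_holds (fun x => cutoff (8 * R) x • u x) hw hE
  refine ⟨hP2, fun x hx => ?_⟩
  have hu3 : ContDiff ℝ 3 u := hu.of_le (by norm_cast)
  have hu2 : ContDiff ℝ 2 u := hu.of_le (by norm_cast)
  have hdiv := hprof.divFree
  -- the source of `ΔP` agrees with `(u·∇)u` near `x`
  have hsrc : (fun y => convect (fun x => cutoff (8 * R) x • u x) (fun x => cutoff (8 * R) x • u x) y +
      VectorCalculus.divergence (fun x => cutoff (8 * R) x • u x) y • (cutoff (8 * R) y • u y)) =ᶠ[𝓝 x]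
      convect u u := by
    filter_upwards [isOpen_ball.mem_nhds hx] with y hy
    have hloc := cutoff_eight_smul_eventuallyEq (u := u) hR hy
    have hfd : fderiv ℝ (fun x => cutoff (8 * R) x • u x) y = fderiv ℝ u y := hloc.fderiv_eq
    have hval : cutoff (8 * R) y • u y = u y := hloc.self_of_nhds
    have hdivw : VectorCalculus.divergence (fun x => cutoff (8 * R) x • u x) y = 0 := by
      unfold VectorCalculus.divergence
      rw [hfd]
      exact hdiv y
    rw [hdivw, zero_smul, add_zero, convect, convect, hfd, hval]
  have hdiv_eq : VectorCalculus.divergence (fun y => convect (fun x => cutoff (8 * R) x • u x)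
        (fun x => cutoff (8 * R) x • u x) y +
      VectorCalculus.divergence (fun x => cutoff (8 * R) x • u x) y • (cutoff (8 * R) y • u y)) x =
      VectorCalculus.divergence (convect u u) x := by
    rw [VectorCalculus.divergence, VectorCalculus.divergence, hsrc.fderiv_eq]
  -- `ΔP x = Δp x`
  have hΔPx : (Δ (normalisedPressure fun x => cutoff (8 * R) x • u x)) x = (Δ p) x := by
    rw [hΔP x, hdiv_eq, divergence_convect_self_eq hu2 hdiv x, hprof.laplacian_pressure_eq hu3 hp x]
  have hsub := (hp.contDiffAt (x := x)).laplacian_sub (hP2.contDiffAt (x := x))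
  rw [hΔPx, sub_self] at hsub
  have e : (p - normalisedPressure fun x => cutoff (8 * R) x • u x) =
      fun y => p y - normalisedPressure (fun x => cutoff (8 * R) x • u x) y := rfl
  rw [e] at hsub
  exact hsub

/-! ### Oscillation of the harmonic part -/

/-- **Oscillation of the harmonic part of the pressure on `B̄(0, 2R)`** (generic form): if
`(u, p)` is a steady solution with `p ∈ C²`, `P ∈ C²`, and `p − P` is harmonic on `B(0, 8R)`,
then for `|x| ≤ 2R`,
`|(p − P)(x) − (p − P)(0)| ≤ 2R (R⁻⁵M₂ ∫_{B̄(0,4R)}|u| + R⁻⁴M₁ ∫_{B̄(0,4R)}|u|² + R⁻⁴M₁ ∫_{B̄(0,4R)}|P|)`: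
the interior gradient bound `abs_fderiv_sub_apply_le_of_steady` at every `y ∈ B̄(0, 2R)`
(`B(y, 4R) ⊆ B(0, 8R)`, `B̄(y, 2R) ⊆ B̄(0, 4R)`) and the mean-value inequality on the convex ball.
[cite: GilbargTrudinger2001, Thm 2.10] -/
theorem abs_sub_sub_le_of_harmonic_on_ball {u : EuclideanSpace ℝ (Fin 3) → EuclideanSpace ℝ (Fin 3)}
    {p P : EuclideanSpace ℝ (Fin 3) → ℝ} (hprof : IsLerayProfile 1 0 u p) (hp : ContDiff ℝ 2 p)
    (hP : ContDiff ℝ 2 P) {R : ℝ} (hR : 0 < R)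
    (hΔ : ∀ x ∈ ball (0 : EuclideanSpace ℝ (Fin 3)) (8 * R), (Δ (fun y => p y - P y)) x = 0)
    {M₁ M₂ : ℝ} (hM₁ : ∀ z : EuclideanSpace ℝ (Fin 3), ‖fderiv ℝ (newtonFarLaplacian 1 2) z‖ ≤ M₁)
    (hM₂ : ∀ z : EuclideanSpace ℝ (Fin 3), |(Δ (newtonFarLaplacian 1 2)) z| ≤ M₂)
    {x : EuclideanSpace ℝ (Fin 3)} (hx : x ∈ closedBall (0 : EuclideanSpace ℝ (Fin 3)) (2 * R)) :
    |(p x - P x) - (p 0 - P 0)| ≤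
      2 * R * (R⁻¹ ^ 5 * M₂ * (∫ w in closedBall (0 : EuclideanSpace ℝ (Fin 3)) (4 * R), ‖u w‖) +
        R⁻¹ ^ 4 * M₁ * (∫ w in closedBall (0 : EuclideanSpace ℝ (Fin 3)) (4 * R), ‖u w‖ ^ 2) +
        R⁻¹ ^ 4 * M₁ * ∫ w in closedBall (0 : EuclideanSpace ℝ (Fin 3)) (4 * R), |P w|) := by
  have hM₁0 : 0 ≤ M₁ := (norm_nonneg _).trans (hM₁ 0)
  have hM₂0 : 0 ≤ M₂ := (abs_nonneg _).trans (hM₂ 0)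
  have huc : Continuous u := hprof.contDiff_velocity.continuous
  set G : ℝ := R⁻¹ ^ 5 * M₂ * (∫ w in closedBall (0 : EuclideanSpace ℝ (Fin 3)) (4 * R), ‖u w‖) +
      R⁻¹ ^ 4 * M₁ * (∫ w in closedBall (0 : EuclideanSpace ℝ (Fin 3)) (4 * R), ‖u w‖ ^ 2) +
      R⁻¹ ^ 4 * M₁ * ∫ w in closedBall (0 : EuclideanSpace ℝ (Fin 3)) (4 * R), |P w| with hG
  have hI1 : 0 ≤ ∫ w in closedBall (0 : EuclideanSpace ℝ (Fin 3)) (4 * R), ‖u w‖ :=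
    integral_nonneg fun _ => norm_nonneg _
  have hI2 : 0 ≤ ∫ w in closedBall (0 : EuclideanSpace ℝ (Fin 3)) (4 * R), ‖u w‖ ^ 2 :=
    integral_nonneg fun _ => sq_nonneg _
  have hI3 : 0 ≤ ∫ w in closedBall (0 : EuclideanSpace ℝ (Fin 3)) (4 * R), |P w| :=
    integral_nonneg fun _ => abs_nonneg _
  have hG0 : 0 ≤ G := by rw [hG]; positivity
  -- gradient bound on the closed ball `B̄(0, 2R)`
  have hgrad : ∀ y ∈ closedBall (0 : EuclideanSpace ℝ (Fin 3)) (2 * R),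
      ‖fderiv ℝ (fun y => p y - P y) y‖ ≤ G := by
    intro y hy
    rw [mem_closedBall_zero_iff] at hy
    -- harmonic on `B(y, 4R) ⊆ B(0, 8R)`
    have hΔy : ∀ w ∈ ball y (4 * R), (Δ (fun y => p y - P y)) w = 0 := fun w hw => by
      refine hΔ w ?_
      rw [mem_ball, dist_eq_norm] at hw
      rw [mem_ball_zero_iff]
      calc ‖w‖ = ‖(w - y) + y‖ := by rw [sub_add_cancel]
        _ ≤ ‖w - y‖ + ‖y‖ := norm_add_le _ _
        _ < 4 * R + 2 * R := add_lt_add_of_lt_of_le hw hy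
        _ ≤ 8 * R := by linarith
    -- the three integrals over `B̄(y, 2R) ⊆ B̄(0, 4R)`
    have hsub : closedBall y (2 * R) ⊆ closedBall (0 : EuclideanSpace ℝ (Fin 3)) (4 * R) := by
      intro w hw
      rw [mem_closedBall, dist_eq_norm] at hw
      rw [mem_closedBall_zero_iff]
      calc ‖w‖ = ‖(w - y) + y‖ := by rw [sub_add_cancel]
        _ ≤ ‖w - y‖ + ‖y‖ := norm_add_le _ _
        _ ≤ 2 * R + 2 * R := add_le_add hw hy
        _ = 4 * R := by ring
    have hmono : ∀ (g : EuclideanSpace ℝ (Fin 3) → ℝ), Continuous g → (∀ w, 0 ≤ g w) →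
        ∫ w in closedBall y (2 * R), g w ≤ ∫ w in closedBall (0 : EuclideanSpace ℝ (Fin 3)) (4 * R), g w :=
      fun g hg hg0 => setIntegral_mono_set
        (hg.continuousOn.integrableOn_compact (isCompact_closedBall _ _))
        (Eventually.of_forall hg0) (Eventually.of_forall hsub)
    have h1 := hmono (fun w => ‖u w‖) huc.norm fun _ => norm_nonneg _
    have h2 := hmono (fun w => ‖u w‖ ^ 2) (by fun_prop) fun _ => sq_nonneg _
    have h3 := hmono (fun w => |P w|) hP.continuous.abs fun _ => abs_nonneg _
    refine ContinuousLinearMap.opNorm_le_bound _ hG0 fun a => ?_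
    rw [Real.norm_eq_abs]
    have key := abs_fderiv_sub_apply_le_of_steady hprof hp hP hR hΔy hM₁ hM₂ a
    calc |fderiv ℝ (fun y => p y - P y) y a|
        ≤ ‖a‖ * (R⁻¹ ^ 5 * M₂ * ∫ w in closedBall y (2 * R), ‖u w‖) +
            ‖a‖ * (R⁻¹ ^ 4 * M₁ * ∫ w in closedBall y (2 * R), ‖u w‖ ^ 2) +
            ‖a‖ * (R⁻¹ ^ 4 * M₁ * ∫ w in closedBall y (2 * R), |P w|) := key
      _ ≤ ‖a‖ * (R⁻¹ ^ 5 * M₂ * ∫ w in closedBall (0 : EuclideanSpace ℝ (Fin 3)) (4 * R), ‖u w‖) +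
            ‖a‖ * (R⁻¹ ^ 4 * M₁ * ∫ w in closedBall (0 : EuclideanSpace ℝ (Fin 3)) (4 * R), ‖u w‖ ^ 2) +
            ‖a‖ * (R⁻¹ ^ 4 * M₁ * ∫ w in closedBall (0 : EuclideanSpace ℝ (Fin 3)) (4 * R), |P w|) := by
          gcongr
      _ = G * ‖a‖ := by rw [hG]; ring
  -- mean-value inequality on the convex ball
  have hdiff : ∀ y ∈ closedBall (0 : EuclideanSpace ℝ (Fin 3)) (2 * R),
      DifferentiableAt ℝ (fun y => p y - P y) y := fun y _ =>
    ((hp.differentiable (by norm_num)).sub (hP.differentiable (by norm_num))) y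
  have h0 : (0 : EuclideanSpace ℝ (Fin 3)) ∈ closedBall (0 : EuclideanSpace ℝ (Fin 3)) (2 * R) :=
    mem_closedBall_self (by positivity)
  have hmv := (convex_closedBall (0 : EuclideanSpace ℝ (Fin 3)) (2 * R)).norm_image_sub_le_of_norm_fderiv_le
    hdiff hgrad h0 hx
  rw [sub_zero, Real.norm_eq_abs] at hmv
  rw [mem_closedBall_zero_iff] at hx
  calc |(p x - P x) - (p 0 - P 0)| ≤ G * ‖x‖ := hmv
    _ ≤ G * (2 * R) := mul_le_mul_of_nonneg_left hx hG0
    _ = 2 * R * G := mul_comm _ _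

/-! ### The Calderón–Zygmund part in `L^{3/2}` -/

/-- **Stein's bound for the Calderón–Zygmund part**: with `C_S = steinConstThreeHalves`,
`∫ |p̃[χu]|^{3/2} ≤ C_S^{3/2} ∫_{B̄(0,16R)} |u|³` (as lower integrals): from
`‖p̃[w]‖_{L^{3/2}} ≤ C_S ‖w‖²_{L³}` (`eLpNorm_normalisedPressure_le_steinConst'`) and
`|w| ≤ 1_{B̄(0,16R)}|u|`. [cite: Stein1971, Ch. II §4.2 Thm 3] -/
theorem lintegral_rpow_normalisedPressure_cutoff_le {u : EuclideanSpace ℝ (Fin 3) → EuclideanSpace ℝ (Fin 3)}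
    (hu : ContDiff ℝ ((⊤ : ℕ∞) : WithTop ℕ∞) u) {R : ℝ} (hR : 0 < R) :
    ∫⁻ x, ‖normalisedPressure (fun x => cutoff (8 * R) x • u x) x‖ₑ ^ (3 / 2 : ℝ) ≤
      (steinConstThreeHalves : ℝ≥0∞) ^ (3 / 2 : ℝ) *
        ∫⁻ x in closedBall (0 : EuclideanSpace ℝ (Fin 3)) (16 * R), ‖u x‖ₑ ^ (3 : ℝ) := by
  have hw := contDiff_cutoff_eight_smul hu R
  have hwc := hasCompactSupport_cutoff_eight_smul (u := u) hR
  have hstein := eLpNorm_normalisedPressure_le_steinConst' hw hwc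
  -- rewrite both `eLpNorm`s as powers of lintegrals
  have h32_0 : (3 / 2 : ℝ≥0∞) ≠ 0 := by norm_num
  have h32_top : (3 / 2 : ℝ≥0∞) ≠ ⊤ := ENNReal.div_ne_top (by norm_num) (by norm_num)
  have h32r : (3 / 2 : ℝ≥0∞).toReal = 3 / 2 := by
    rw [ENNReal.toReal_div]; norm_num
  have h3r : (3 : ℝ≥0∞).toReal = 3 := by norm_num
  rw [eLpNorm_eq_lintegral_rpow_enorm_toReal h32_0 h32_top, h32r,
    eLpNorm_eq_lintegral_rpow_enorm_toReal (by norm_num) (by norm_num), h3r] at hstein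
  -- `hstein : (∫⁻ |P|ₑ^{3/2})^{2/3} ≤ C (∫⁻ |w|ₑ³)^{1/3})²`; raise to the power `3/2`
  set IP : ℝ≥0∞ := ∫⁻ x, ‖normalisedPressure (fun x => cutoff (8 * R) x • u x) x‖ₑ ^ (3 / 2 : ℝ) with hIP
  set IW : ℝ≥0∞ := ∫⁻ x, ‖cutoff (8 * R) x • u x‖ₑ ^ (3 : ℝ) with hIW
  have hraise := ENNReal.rpow_le_rpow hstein (by norm_num : (0 : ℝ) ≤ 3 / 2)
  have e1 : (IP ^ (1 / (3 / 2) : ℝ)) ^ (3 / 2 : ℝ) = IP := by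
    rw [← ENNReal.rpow_mul]; norm_num
  have e2 : ((steinConstThreeHalves : ℝ≥0∞) * (IW ^ (1 / 3 : ℝ)) ^ 2) ^ (3 / 2 : ℝ) =
      (steinConstThreeHalves : ℝ≥0∞) ^ (3 / 2 : ℝ) * IW := by
    rw [ENNReal.mul_rpow_of_nonneg _ _ (by norm_num : (0 : ℝ) ≤ 3 / 2), ← ENNReal.rpow_natCast,
      ← ENNReal.rpow_mul, ← ENNReal.rpow_mul]
    norm_num
  rw [e1, e2] at hraise
  -- `∫⁻ |w|ₑ³ ≤ ∫⁻_{B̄(0,16R)} |u|ₑ³`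
  have hIW : IW ≤ ∫⁻ x in closedBall (0 : EuclideanSpace ℝ (Fin 3)) (16 * R), ‖u x‖ₑ ^ (3 : ℝ) := by
    rw [hIW, ← lintegral_indicator measurableSet_closedBall]
    refine lintegral_mono fun x => ?_
    by_cases hx : x ∈ closedBall (0 : EuclideanSpace ℝ (Fin 3)) (16 * R)
    · rw [indicator_of_mem hx]
      refine ENNReal.rpow_le_rpow ?_ (by norm_num)
      rw [← ofReal_norm, ← ofReal_norm]
      have h := norm_cutoff_eight_smul_le (u := u) hR x
      rw [indicator_of_mem hx] at h
      exact ENNReal.ofReal_le_ofReal h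
    · rw [indicator_of_notMem hx, cutoff_eight_smul_eq_zero hR hx, enorm_zero, ENNReal.zero_rpow_of_pos (by norm_num)]
  exact hraise.trans (mul_le_mul' le_rfl hIW)

end Literature.Analysis.FluidPDE

end
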